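import Mathlib.Analysis.Complex.Basic
import Mathlib.LinearAlgebra.UnitaryGroup
import Literature.Computability.QuantumComplexity.PauliParseval
import Literature.Computability.Cryptography.QubitRegister
import Summits.QuantumAdvantage.QuantumAdvantage.Theorems.SymplecticPurityDefs

/-!
# Route `SymplecticPurity`, item `NoFreeFrame` (stmt-QuantumAdvantage-10731) — purity as spectral mass

Helper file (no ancillas, `m = 0` case of the route's purity bound):

* `sum_stringsOn_kernel` : `Σ_{S ∈ 𝒫^W} S_{xy} conj(S_{x'y'}) = 2^{|W|} [x|_W = x'|_W][y|_W = y'|_W]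
  [x|_{Wᶜ} = y|_{Wᶜ}][x'|_{Wᶜ} = y'|_{Wᶜ}]` (completeness of the Pauli strings, all labels);
* `two_pow_mul_puritySum` : the 4-fold agreement sum of the route (`Tr ρ_{<k}²`) is
  `2^{-k} Σ_{S ∈ 𝒫^{<k}} |⟨φ|S|φ⟩|²`;
* `clifford_conj_surjective` : a unitary normalising the Pauli group (semantically) also
  conjugates every Pauli string BACK to a phase times a Pauli string, identity only for the identity;
* `norm_puritySum_mulVec_le` : for a unit `ε`-flat `ψ` and any such `U`, every linear cut of `U ψ`
  has purity `≤ 2^{-k} + 2^k ε²`.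
-/

noncomputable section

set_option linter.dupNamespace false -- D-0017: single-problem summit ⇒ `QuantumAdvantage.QuantumAdvantage` by design

namespace Summit.QuantumAdvantage.QuantumAdvantage.Theorems.SymplecticPurity

open Matrix Finset
open Literature.Computability.QuantumComplexity Literature.Computability.Cryptography

variable {N : ℕ}

/-! ### The completeness kernel on a wire set, all labels -/

/-- One-site kernel off the wire set: only the identity is summed. -/
theorem sum_singleton_I_mat (a b c d : Bool) :
    ∑ Q ∈ ({Pauli.I} : Finset Pauli), Pauli.mat Q a b * Pauli.mat Q d c =
      if a = b ∧ d = c then 1 else 0 := by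
  rw [Finset.sum_singleton]
  simp only [Pauli.mat, Matrix.one_apply]
  by_cases h1 : a = b <;> by_cases h2 : d = c <;> simp [h1, h2]

/-- **Completeness kernel on `W`, arbitrary labels**:
`Σ_{S ∈ 𝒫^W} S_{xy} conj(S_{x'y'}) = 2^{|W|}` if `x, x'` and `y, y'` agree on `W` while `x, y` and
`x', y'` agree off `W`, and `0` otherwise. -/
theorem sum_stringsOn_kernel (W : Finset (Fin N)) (x y x' y' : Fin N → Bool) :
    ∑ S ∈ stringsOn W, pauliString S x y * star (pauliString S x' y') =
      if (∀ i, i ∈ W → x i = x' i ∧ y i = y' i) ∧ (∀ i, i ∉ W → x i = y i ∧ x' i = y' i) then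
        (2 : ℂ) ^ W.card else 0 := by
  classical
  have hstar : ∀ S : Fin N → Pauli, star (pauliString S x' y') = pauliString S y' x' := fun S => by
    have := congrFun (congrFun (conjTranspose_pauliString S) y') x'
    rwa [Matrix.conjTranspose_apply] at this
  simp only [hstar]
  simp only [pauliString_eq, tensorAll_apply, ← Finset.prod_mul_distrib, stringsOn]
  rw [← Finset.prod_univ_sum (fun i => if i ∈ W then Finset.univ else {Pauli.I})
    (fun i Q => Pauli.mat Q (x i) (y i) * Pauli.mat Q (y' i) (x' i))]
  have key : ∀ i, (∑ Q ∈ (if i ∈ W then Finset.univ else {Pauli.I}),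
      Pauli.mat Q (x i) (y i) * Pauli.mat Q (y' i) (x' i)) =
      if i ∈ W then (if x i = x' i ∧ y i = y' i then 2 else 0)
      else (if x i = y i ∧ x' i = y' i then 1 else 0) := by
    intro i
    by_cases hi : i ∈ W
    · simp only [hi, if_true, Pauli.sum_mat_mul_mat]
    · rw [if_neg hi, if_neg hi, sum_singleton_I_mat]
      by_cases h1 : x i = y i <;> by_cases h2 : x' i = y' i <;> simp [h1, h2, eq_comm]
  simp only [key]
  by_cases hcond : (∀ i, i ∈ W → x i = x' i ∧ y i = y' i) ∧ (∀ i, i ∉ W → x i = y i ∧ x' i = y' i)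
  · rw [if_pos hcond]
    have : ∀ i, (if i ∈ W then (if x i = x' i ∧ y i = y' i then (2 : ℂ) else 0)
        else (if x i = y i ∧ x' i = y' i then 1 else 0)) = if i ∈ W then 2 else 1 := by
      intro i
      by_cases hi : i ∈ W
      · rw [if_pos hi, if_pos hi, if_pos (hcond.1 i hi)]
      · rw [if_neg hi, if_neg hi, if_pos (hcond.2 i hi)]
    simp only [this]
    rw [Finset.prod_ite, Finset.prod_const_one, mul_one, Finset.prod_const]
    congr 1
    simp
  · rw [if_neg hcond]
    have : ∃ i, (if i ∈ W then (if x i = x' i ∧ y i = y' i then (2 : ℂ) else 0)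
        else (if x i = y i ∧ x' i = y' i then 1 else 0)) = 0 := by
      by_contra hc
      push Not at hc
      apply hcond
      constructor
      · intro i hi
        have := hc i
        rw [if_pos hi] at this
        by_contra h'
        exact this (if_neg h')
      · intro i hi
        have := hc i
        rw [if_neg hi] at this
        by_contra h'
        exact this (if_neg h')
    obtain ⟨i, hi⟩ := this
    exact Finset.prod_eq_zero (Finset.mem_univ i) hi


/-! ### Purity as spectral mass -/

/-- The squared modulus of a Pauli expectation as a 4-fold sum over labels. -/
theorem norm_sq_pauliExp (S : Fin N → Pauli) (φ : QReg N → ℂ) :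
    ((‖pauliExp S φ‖ ^ 2 : ℝ) : ℂ) =
      ∑ x, ∑ y, ∑ x', ∑ y', (starRingEnd ℂ) (φ x) * φ y * φ x' * (starRingEnd ℂ) (φ y') *
        (pauliString S x y * star (pauliString S x' y')) := by
  rw [show (((‖pauliExp S φ‖ ^ 2 : ℝ) : ℂ)) = pauliExp S φ * (starRingEnd ℂ) (pauliExp S φ) by
    rw [Complex.mul_conj']; push_cast; rfl]
  have h1 : pauliExp S φ = ∑ x, ∑ y, (starRingEnd ℂ) (φ x) * pauliString S x y * φ y := by
    simp only [pauliExp, dotProduct, Matrix.mulVec, Pi.star_apply, Complex.star_def, Finset.mul_sum]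
    refine Finset.sum_congr rfl fun x _ => Finset.sum_congr rfl fun y _ => by ring
  rw [h1]
  simp only [map_sum]
  rw [Finset.sum_mul]
  refine Finset.sum_congr rfl fun x _ => ?_
  rw [Finset.sum_mul]
  refine Finset.sum_congr rfl fun y _ => ?_
  rw [Finset.mul_sum]
  refine Finset.sum_congr rfl fun x' _ => ?_
  rw [Finset.mul_sum]
  refine Finset.sum_congr rfl fun y' _ => ?_
  simp only [map_mul, Complex.conj_conj]
  rw [Complex.star_def]
  ring

/-- Membership in the cut set. -/
@[simp] theorem mem_cutSet {k : ℕ} {i : Fin N} : i ∈ cutSet N k ↔ i.val < k := by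
  simp [cutSet]

/-- The cut set of a cut `k ≤ N` has `k` wires. -/
theorem card_cutSet {k : ℕ} (hk : k ≤ N) : (cutSet N k).card = k := by
  have : cutSet N k = (Finset.univ : Finset (Fin k)).map (Fin.castLEEmb hk) := by
    ext i
    simp only [mem_cutSet, Finset.mem_map, Finset.mem_univ, true_and]
    constructor
    · intro hi; exact ⟨⟨i.val, hi⟩, Fin.ext rfl⟩
    · rintro ⟨j, rfl⟩; exact j.isLt
  rw [this, Finset.card_map, Finset.card_univ, Fintype.card_fin]

/-- **Purity is spectral mass** (the `m = 0` heart of the route's mechanism):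
`2^k · Tr ρ_{<k}² = Σ_{S ∈ 𝒫^{<k}} |⟨φ|S|φ⟩|²` for every cut `k ≤ N`, with `Tr ρ_{<k}²` the 4-fold
agreement sum `puritySum k φ`. -/
theorem two_pow_mul_puritySum {k : ℕ} (hk : k ≤ N) (φ : QReg N → ℂ) :
    (2 : ℂ) ^ k * puritySum k φ = ∑ S ∈ stringsOn (cutSet N k), ((‖pauliExp S φ‖ ^ 2 : ℝ) : ℂ) := by
  classical
  simp only [norm_sq_pauliExp]
  rw [Finset.sum_comm]
  simp only [Finset.sum_comm (s := stringsOn (cutSet N k)), ← Finset.mul_sum, sum_stringsOn_kernel,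
    card_cutSet hk, mem_cutSet]
  -- swap the first two labels on the right (`x ↔ y`) to align the conjugations with `puritySum`
  conv_rhs => rw [Finset.sum_comm]
  rw [puritySum, Finset.mul_sum]
  refine Finset.sum_congr rfl fun x₁ _ => ?_
  rw [Finset.mul_sum]
  refine Finset.sum_congr rfl fun x₂ _ => ?_
  rw [Finset.mul_sum]
  refine Finset.sum_congr rfl fun x₃ _ => ?_
  rw [Finset.mul_sum]
  refine Finset.sum_congr rfl fun x₄ _ => ?_
  by_cases h : (∀ i, k ≤ i.val → x₁ i = x₂ i) ∧ (∀ i, i.val < k → x₂ i = x₃ i) ∧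
      (∀ i, k ≤ i.val → x₃ i = x₄ i) ∧ (∀ i, i.val < k → x₄ i = x₁ i)
  · rw [if_pos h, if_pos]
    · simp only [Complex.star_def]; ring
    · refine ⟨fun i hi => ⟨h.2.1 i hi, (h.2.2.2 i hi).symm⟩, fun i hi => ?_⟩
      have hi' : k ≤ i.val := Nat.le_of_not_lt hi
      exact ⟨(h.1 i hi').symm, h.2.2.1 i hi'⟩
  · rw [if_neg h, if_neg, mul_zero, mul_zero]
    intro h'
    apply h
    refine ⟨fun i hi => ((h'.2 i (Nat.not_lt.2 hi)).1).symm, fun i hi => (h'.1 i hi).1,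
      fun i hi => (h'.2 i (Nat.not_lt.2 hi)).2, fun i hi => ((h'.1 i hi).2).symm⟩


/-! ### Clifford unitaries, read backwards -/

/-- A Pauli string that is a scalar multiple of another one is that one. -/
theorem pauliString_eq_of_smul_eq {c : ℂ} {S T : Fin N → Pauli}
    (h : c • pauliString S = pauliString T) : S = T := by
  classical
  have ht := congrArg (fun M => (pauliString T * M).trace) h
  simp only [Matrix.mul_smul, Matrix.trace_smul, trace_pauliString_mul_pauliString,
    smul_eq_mul] at ht
  by_contra hne
  rw [if_neg (Ne.symm hne), if_pos trivial, mul_zero] at ht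
  exact absurd ht.symm (pow_ne_zero _ two_ne_zero)

/-- **Clifford unitaries conjugate Pauli strings back to Pauli strings.** If `U` is unitary and
`U σ_S U† = c_S σ_{S'}` (`|c_S| = 1`) for every Pauli string `S`, then `S ↦ S'` is a bijection, so for
every `S` there are `T` and a unit `c` with `U† σ_S U = c σ_T`, and `T = I` only if `S = I`. -/
theorem clifford_conj_back {U : Matrix (QReg N) (QReg N) ℂ} (hU : U ∈ Matrix.unitaryGroup (QReg N) ℂ)
    (hcl : ∀ S : Fin N → Pauli, ∃ S' : Fin N → Pauli, ∃ c : ℂ, ‖c‖ = 1 ∧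
      U * pauliString S * star U = c • pauliString S')
    (S : Fin N → Pauli) :
    ∃ T : Fin N → Pauli, ∃ c : ℂ, ‖c‖ = 1 ∧ star U * pauliString S * U = c • pauliString T ∧
      (T = (fun _ => Pauli.I) → S = fun _ => Pauli.I) := by
  classical
  have hU1 : star U * U = 1 := Matrix.mem_unitaryGroup_iff'.1 hU
  have hU2 : U * star U = 1 := Matrix.mem_unitaryGroup_iff.1 hU
  choose Φ c hc hΦ using hcl
  -- `Φ` is injective
  have hinj : Function.Injective Φ := by
    intro S₁ S₂ h12
    have e0 : ∀ S₀, pauliString S₀ = c S₀ • (star U * pauliString (Φ S₀) * U) := by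
      intro S₀
      rw [← Matrix.smul_mul, ← Matrix.mul_smul, ← hΦ S₀]
      simp only [Matrix.mul_assoc, hU1, Matrix.mul_one]
      rw [← Matrix.mul_assoc, hU1, Matrix.one_mul]
    have e1 := e0 S₁
    have e2 := e0 S₂
    have hc2 : c S₂ ≠ 0 := fun h0 => by have := hc S₂; rw [h0, norm_zero] at this; exact zero_ne_one this
    have : (c S₁ * (c S₂)⁻¹) • pauliString S₂ = pauliString S₁ := by
      rw [e1, e2, h12, smul_smul, mul_assoc, inv_mul_cancel₀ hc2, mul_one]
    exact (pauliString_eq_of_smul_eq this).symm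
  have hsurj : Function.Surjective Φ := Finite.injective_iff_surjective.1 hinj
  obtain ⟨T, hT⟩ := hsurj S
  have hcT : c T ≠ 0 := fun h0 => by have := hc T; rw [h0, norm_zero] at this; exact zero_ne_one this
  refine ⟨T, (c T)⁻¹, by rw [norm_inv, hc T, inv_one], ?_, ?_⟩
  · -- `U† σ_S U = c_T⁻¹ σ_T`
    have h := hΦ T
    rw [hT] at h
    have h' : star U * (U * pauliString T * star U) * U = star U * (c T • pauliString S) * U := by rw [h]
    rw [Matrix.mul_smul, Matrix.smul_mul] at h'
    have lhs : star U * (U * pauliString T * star U) * U = pauliString T := by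
      simp only [Matrix.mul_assoc, hU1, Matrix.mul_one]
      rw [← Matrix.mul_assoc, hU1, Matrix.one_mul]
    rw [lhs] at h'
    rw [h', smul_smul, inv_mul_cancel₀ hcT, one_smul]
  · intro hTI
    have h := hΦ T
    have hT1 : pauliString T = 1 := by rw [hTI, pauliString_const_I]
    rw [hT, hT1, Matrix.mul_one, hU2] at h
    exact pauliString_eq_of_smul_eq (c := c T) (by rw [pauliString_const_I]; exact h.symm)

/-- The expectation of `σ_S` in `U ψ` is the expectation of `U† σ_S U` in `ψ`. -/
theorem pauliExp_mulVec (U : Matrix (QReg N) (QReg N) ℂ) (S : Fin N → Pauli) (ψ : QReg N → ℂ) :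
    pauliExp S (U.mulVec ψ) = star ψ ⬝ᵥ (star U * pauliString S * U).mulVec ψ := by
  rw [pauliExp, Matrix.star_mulVec, ← Matrix.dotProduct_mulVec, Matrix.mulVec_mulVec,
    Matrix.mulVec_mulVec, Matrix.star_eq_conjTranspose]

/-- The expectation of the identity string is the squared norm. -/
theorem pauliExp_const_I (ψ : QReg N → ℂ) :
    pauliExp (fun _ => Pauli.I) ψ = ((normSq ψ : ℝ) : ℂ) := by
  rw [pauliExp, pauliString_const_I, Matrix.one_mulVec, normSq]
  push_cast
  simp only [dotProduct, Pi.star_apply, Complex.star_def]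
  exact Finset.sum_congr rfl fun x _ => Complex.conj_mul' _

/-! ### The purity bound in every Clifford frame (no ancillas) -/

/-- The number of Pauli strings on a `k`-set is `4^k`. -/
theorem card_stringsOn (W : Finset (Fin N)) : (stringsOn W).card = 4 ^ W.card := by
  classical
  rw [stringsOn, Fintype.card_piFinset]
  rw [← Finset.prod_const, ← Finset.prod_filter_mul_prod_filter_not Finset.univ (· ∈ W)]
  have h1 : ∏ i ∈ Finset.univ.filter (· ∈ W), (if i ∈ W then (Finset.univ : Finset Pauli) else {Pauli.I}).card
      = ∏ i ∈ Finset.univ.filter (· ∈ W), 4 :=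
    Finset.prod_congr rfl fun i hi => by
      rw [Finset.mem_filter] at hi; rw [if_pos hi.2, Finset.card_univ, Pauli.card_univ]
  have h2 : ∏ i ∈ Finset.univ.filter (fun i => ¬ i ∈ W),
      (if i ∈ W then (Finset.univ : Finset Pauli) else {Pauli.I}).card = 1 :=
    Finset.prod_eq_one fun i hi => by
      rw [Finset.mem_filter] at hi; rw [if_neg hi.2, Finset.card_singleton]
  rw [h1, h2, mul_one]
  congr 1
  ext i; simp

/-- **Purity bound in every Clifford frame, no ancillas.** If `ψ` is a unit vector on `N` qubits with
`|⟨ψ|σ_S|ψ⟩| ≤ ε` for all `S ≠ I`, `U` is unitary and normalises the Pauli group up to phases, then for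
every cut `k ≤ N` the purity of `U ψ` across `{wires < k}` is at most `2^{-k} + 2^k ε²`. -/
theorem norm_puritySum_mulVec_le {ε : ℝ} {ψ : QReg N → ℂ} (hψ : normSq ψ = 1)
    (hflat : ∀ S : Fin N → Pauli, S ≠ (fun _ => Pauli.I) → ‖pauliExp S ψ‖ ≤ ε)
    {U : Matrix (QReg N) (QReg N) ℂ} (hU : U ∈ Matrix.unitaryGroup (QReg N) ℂ)
    (hcl : ∀ S : Fin N → Pauli, ∃ S' : Fin N → Pauli, ∃ c : ℂ, ‖c‖ = 1 ∧
      U * pauliString S * star U = c • pauliString S')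
    {k : ℕ} (hk : k ≤ N) :
    ‖puritySum k (U.mulVec ψ)‖ ≤ (2 : ℝ)⁻¹ ^ k + 2 ^ k * ε ^ 2 := by
  classical
  have hε : 0 ≤ ε ^ 2 := sq_nonneg ε
  -- each non-identity term is at most `ε²`, the identity term is `1`
  have hterm : ∀ S ∈ stringsOn (cutSet N k), ‖pauliExp S (U.mulVec ψ)‖ ^ 2 ≤
      if S = (fun _ => Pauli.I) then 1 else ε ^ 2 := by
    intro S _
    obtain ⟨T, c, hc, hconj, hTI⟩ := clifford_conj_back hU hcl S
    have hexp : pauliExp S (U.mulVec ψ) = c * pauliExp T ψ := by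
      rw [pauliExp_mulVec, hconj, Matrix.smul_mulVec, dotProduct_smul, smul_eq_mul, pauliExp]
    by_cases hS : S = fun _ => Pauli.I
    · rw [if_pos hS]
      subst hS
      rw [pauliExp_mulVec]
      have : star U * pauliString (fun _ : Fin N => Pauli.I) * U = 1 := by
        rw [pauliString_const_I, Matrix.mul_one, Matrix.mem_unitaryGroup_iff'.1 hU]
      rw [this, Matrix.one_mulVec]
      have h1 : star ψ ⬝ᵥ ψ = ((normSq ψ : ℝ) : ℂ) := by
        rw [← pauliExp_const_I, pauliExp, pauliString_const_I, Matrix.one_mulVec]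
      rw [h1, hψ]; simp
    · rw [if_neg hS, hexp, norm_mul, hc, one_mul]
      have hT : T ≠ fun _ => Pauli.I := fun h => hS (hTI h)
      have := hflat T hT
      exact pow_le_pow_left₀ (norm_nonneg _) this 2
  have hsum : ∑ S ∈ stringsOn (cutSet N k), ‖pauliExp S (U.mulVec ψ)‖ ^ 2 ≤ 1 + 4 ^ k * ε ^ 2 := by
    refine (Finset.sum_le_sum hterm).trans ?_
    rw [Finset.sum_ite, Finset.sum_const, Finset.sum_const, nsmul_eq_mul, nsmul_eq_mul, mul_one]
    have hI : (stringsOn (cutSet N k)).filter (fun S => S = fun _ => Pauli.I) ⊆ {fun _ => Pauli.I} := by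
      intro S hS; rw [Finset.mem_filter] at hS; rw [Finset.mem_singleton]; exact hS.2
    have c1 : (((stringsOn (cutSet N k)).filter (fun S => S = fun _ => Pauli.I)).card : ℝ) ≤ 1 := by
      exact_mod_cast (Finset.card_le_card hI).trans (Finset.card_singleton _).le
    have c2 : (((stringsOn (cutSet N k)).filter (fun S => ¬ S = fun _ => Pauli.I)).card : ℝ) ≤ 4 ^ k := by
      have := (Finset.card_filter_le (stringsOn (cutSet N k)) (fun S => ¬ S = fun _ => Pauli.I))
      rw [card_stringsOn, card_cutSet hk] at this
      exact_mod_cast this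
    nlinarith
  -- put together through `two_pow_mul_puritySum`
  have hid := two_pow_mul_puritySum hk (U.mulVec ψ)
  have hnorm : (2 : ℝ) ^ k * ‖puritySum k (U.mulVec ψ)‖ =
      ∑ S ∈ stringsOn (cutSet N k), ‖pauliExp S (U.mulVec ψ)‖ ^ 2 := by
    have := congrArg norm hid
    rw [norm_mul, Complex.norm_pow, Complex.norm_ofNat] at this
    rw [this, ← Complex.ofReal_sum, Complex.norm_real, Real.norm_of_nonneg]
    exact Finset.sum_nonneg fun _ _ => sq_nonneg _
  have h2k : (0 : ℝ) < 2 ^ k := pow_pos two_pos k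
  have hmain : (2 : ℝ) ^ k * ‖puritySum k (U.mulVec ψ)‖ ≤ 1 + 4 ^ k * ε ^ 2 := by
    rw [hnorm]; exact hsum
  have h4 : (4 : ℝ) ^ k = 2 ^ k * 2 ^ k := by rw [← mul_pow]; norm_num
  rw [h4, mul_assoc] at hmain
  have hdiv : ‖puritySum k (U.mulVec ψ)‖ ≤ (1 + 2 ^ k * (2 ^ k * ε ^ 2)) / 2 ^ k := by
    rw [le_div_iff₀ h2k]; linarith
  calc ‖puritySum k (U.mulVec ψ)‖ ≤ (1 + 2 ^ k * (2 ^ k * ε ^ 2)) / 2 ^ k := hdiv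
    _ = (2 : ℝ)⁻¹ ^ k + 2 ^ k * ε ^ 2 := by
        rw [inv_pow, add_div, mul_div_cancel_left₀ _ h2k.ne', one_div]

end Summit.QuantumAdvantage.QuantumAdvantage.Theorems.SymplecticPurity
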